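import Summits.CriticalPhenomena.PercolationContinuityZ3.Theorems.PercNearOneGluingNoHeavyLowerTailSahiSunflowerTowerSymmetry
import Literature.Combinatorics.Sahi2008.UniformSquareAllOrders
import Mathlib.Tactic.Linarith
import Mathlib.Tactic.Ring
import HarnessLib

/-!
# `NoHeavyLowerTail` (crux stmt-CriticalPhenomena-4575), master-family line P2 (Sahi's algebraic route):
# NULL PETALS of the sunflower poset `Sun m` — `E_n` only sees live cells, and the row with null petals factors through the sub-row

Support file (seat `prim-masterthm-p2`, gen 4; `--supports stmt-CriticalPhenomena-4575`); no definition, no named fact, no sorry.  Memo SAHI-ROUTE.md §4.13.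
The base case of the petal-transfer induction for the all-`m` hierarchy theorem:
* `sahiE_congr_ae`, `sahiE_U_congr_of_null` — families that agree off the null cells have the same `E_n` (moment congruence
  `sahiE_congr_of_moments`);
* `sahiE_snoc_U_univ` — a slot holding `χ_{U univ} = 1 − χ_{core}` is peeled with the factor `(N − 1 + ν core)` (branching + an annihilating cell);
* `sahiE_subrow_nonneg_of_null` — if every petal outside the injective range `x : Fin (n+2) ↪ Fin m` is NULL and the top row `E_m(D) ≥ 0`, then the
  sub-row `E_{n+2}(χ_{U([m] ∖ x i)} : i) ≥ 0` (the null members of the row are a.e. `χ_{U univ}` and peel off with positive factors).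
-/

namespace Summit.CriticalPhenomena.PercolationContinuityZ3.Theorems.SahiDeltaSystem

open Finset Function Literature.Combinatorics.Sahi2008

namespace Sun

section AE

variable {α : Type*} [Fintype α]

/-- Expectations only see the support of the weight. [this work] -/
theorem ex_congr_ae {μ : α → ℝ} {f g : α → ℝ} (h : ∀ y, μ y ≠ 0 → f y = g y) : ex μ f = ex μ g := by
  rw [ex_def, ex_def]
  refine Finset.sum_congr rfl fun y _ => ?_
  by_cases hy : μ y = 0
  · rw [hy, zero_mul, zero_mul]
  · rw [h y hy]

/-- **`E_n` only sees the support of the weight**: families agreeing on `{μ ≠ 0}` have the same `E_n`. [this work] -/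
theorem sahiE_congr_ae (μ : α → ℝ) {n : ℕ} {f g : Fin n → α → ℝ} (h : ∀ i y, μ y ≠ 0 → f i y = g i y) :
    sahiE μ n f = sahiE μ n g := by
  refine sahiE_congr_of_moments μ μ n f g fun S _ => ex_congr_ae fun y hy => ?_
  rw [Finset.prod_apply, Finset.prod_apply]
  exact Finset.prod_congr rfl fun i _ => h i y hy

end AE

variable {m : ℕ}

/-- **`U`-families that differ only by null petals have the same `E_n`.** [this work] -/
theorem sahiE_U_congr_of_null (ν : Sun m → ℝ) {n : ℕ} {S S' : Fin n → Finset (Fin m)}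
    (h : ∀ l (i : Fin m), ν (pet i) ≠ 0 → (i ∈ S l ↔ i ∈ S' l)) :
    sahiE ν n (fun l => setInd (U (S l))) = sahiE ν n (fun l => setInd (U (S' l))) := by
  refine sahiE_congr_ae ν fun l y hy => ?_
  rcases y with _ | i | _
  · simp [setInd_apply]
  · simp only [setInd_apply, pet_mem_U, h l i hy]
  · simp [setInd_apply]

/-- `χ_{U univ} = 1 − χ_{core}` on `Sun m`. [this work] -/
theorem setInd_U_univ_eq : setInd (U (univ : Finset (Fin m))) = (fun _ => (1 : ℝ)) - setInd {core} := by
  funext y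
  rcases y with _ | i | _ <;> simp [setInd_apply]

/-- **Peeling a `χ_{U univ}` slot**: for `N ≥ 1` and a family vanishing at the core (e.g. indicators of proper up-sets),
`E_{N+1}(g, χ_{U univ}) = (N − 1 + ν core)·E_N(g)` (branching `E_{N+1}(g, 1) = (N−1)E_N(g)` and the annihilating cell `{core}`). [this work] -/
theorem sahiE_snoc_U_univ {ν : Sun m → ℝ} (hν1 : ∑ y, ν y = 1) {N : ℕ} (hN : 1 ≤ N) (g : Fin N → Sun m → ℝ)
    (hg : ∀ i, g i core = 0) :
    sahiE ν (N + 1) (Fin.snoc g (setInd (U (univ : Finset (Fin m)))) : Fin (N + 1) → Sun m → ℝ) = ((N : ℝ) - 1 + ν core) * sahiE ν N g := by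
  obtain ⟨N', rfl⟩ : ∃ N', N = N' + 1 := ⟨N - 1, by omega⟩
  have hlin : (Fin.snoc g (setInd (U (univ : Finset (Fin m)))) : Fin (N' + 2) → Sun m → ℝ) =
      update (Fin.snoc g 0) (Fin.last (N' + 1)) ((1 : ℝ) • (fun _ => (1 : ℝ)) + (-1 : ℝ) • setInd {core}) := by
    rw [Fin.update_snoc_last, setInd_U_univ_eq]
    congr 1
    funext y; simp; ring
  rw [hlin, sahiE_update_lin, Fin.update_snoc_last, Fin.update_snoc_last]
  have h1 : sahiE ν (N' + 2) (Fin.snoc g (fun _ => (1 : ℝ)) : Fin (N' + 2) → Sun m → ℝ) = N' * sahiE ν (N' + 1) g :=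
    sahiE_snoc_one hν1 N' g
  have h2 : sahiE ν (N' + 2) (Fin.snoc g (setInd {core}) : Fin (N' + 2) → Sun m → ℝ) = -(sahiE ν (N' + 1) g * ν core) := by
    rw [sahiE_snoc]
    have hann : ∀ i, g i * setInd ({core} : Finset (Sun m)) = 0 := by
      intro i; funext y
      rcases y with _ | k | _
      · simp [hg i]
      · simp [setInd_apply]
      · simp [setInd_apply]
    simp only [hann, sahiE_update_zero, Finset.sum_const_zero, zero_sub]
    congr 1
    rw [ex_def, sum_eq]
    simp [setInd_apply]
  rw [h1, h2]
  push_cast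
  ring

/-- The members of the row vanish at the core. [this work] -/
theorem setInd_U_core (S : Finset (Fin m)) : setInd (U S) core = 0 := by simp [setInd_apply]

/-- **Peeling null petals off a sub-row.**  If the last `r` indices of `e : Fin ((n+2)+r) → Fin m` are null petals and
`E_{(n+2)+r}(χ_{U([m] ∖ e i)} : i) ≥ 0`, then `E_{n+2}` of the first `n+2` members is `≥ 0`. [this work] -/
theorem sahiE_subrow_nonneg_peel {ν : Sun m → ℝ} (hν0 : ∀ y, 0 ≤ ν y) (hν1 : ∑ y, ν y = 1) {n : ℕ} :
    ∀ (r : ℕ) (e : Fin ((n + 2) + r) → Fin m), (∀ i : Fin r, ν (pet (e (Fin.natAdd (n + 2) i))) = 0) →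
      0 ≤ sahiE ν ((n + 2) + r) (fun i => setInd (U (univ.erase (e i)))) →
        0 ≤ sahiE ν (n + 2) (fun i => setInd (U (univ.erase (e (Fin.castAdd r i)))))
  | 0, e, _, h => by
    have he : (fun i : Fin (n + 2) => setInd (U (univ.erase (e (Fin.castAdd 0 i))))) = fun i => setInd (U (univ.erase (e i))) := by
      funext i; rfl
    rw [he]; exact h
  | r + 1, e, hnull, h => by
    -- the family on `Fin ((n+2)+r+1)`, split off the last slot
    set f : Fin ((n + 2) + r + 1) → Sun m → ℝ := fun i => setInd (U (univ.erase (e i))) with hf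
    have hlast : ν (pet (e (Fin.last ((n + 2) + r)))) = 0 := by
      have key := hnull (Fin.last r)
      have hidx : (Fin.natAdd (n + 2) (Fin.last r) : Fin ((n + 2) + (r + 1))) = Fin.last ((n + 2) + r) := by
        apply Fin.ext; simp
      rw [hidx] at key; exact key
    -- a.e. the last slot is `χ_{U univ}`
    have hae : sahiE ν ((n + 2) + r + 1) f =
        sahiE ν ((n + 2) + r + 1) (Fin.snoc (Fin.init f) (setInd (U (univ : Finset (Fin m)))) : Fin ((n + 2) + r + 1) → Sun m → ℝ) := by
      refine sahiE_congr_ae ν fun i y hy => ?_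
      by_cases hi : i = Fin.last ((n + 2) + r)
      · subst hi
        rw [Fin.snoc_last, hf]
        dsimp only
        rcases y with _ | k | _
        · simp [setInd_apply]
        · have hk : k ≠ e (Fin.last ((n + 2) + r)) := fun hke => hy (by rw [hke]; exact hlast)
          simp [setInd_apply, hk]
        · simp [setInd_apply]
      · obtain ⟨i', rfl⟩ : ∃ i' : Fin ((n + 2) + r), i = Fin.castSucc i' :=
          ⟨i.castPred hi, (Fin.castSucc_castPred i hi).symm⟩
        rw [Fin.snoc_castSucc, Fin.init]
    have hpeel := sahiE_snoc_U_univ hν1 (N := (n + 2) + r) (by omega) (Fin.init f) (fun i => by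
      rw [Fin.init, hf]; exact setInd_U_core _)
    have hpos : (0 : ℝ) < (((n + 2) + r : ℕ) : ℝ) - 1 + ν core := by
      have := hν0 core; push_cast; linarith
    have hinit : 0 ≤ sahiE ν ((n + 2) + r) (Fin.init f) := by
      have h' : 0 ≤ sahiE ν ((n + 2) + r + 1) f := h
      rw [hae, hpeel] at h'
      exact nonneg_of_mul_nonneg_right h' hpos
    -- the induction hypothesis for `e ∘ castSucc`
    have key := sahiE_subrow_nonneg_peel hν0 hν1 r (fun i => e (Fin.castSucc i)) (fun i => by
      have hidx : (Fin.castSucc (Fin.natAdd (n + 2) i) : Fin ((n + 2) + (r + 1))) = Fin.natAdd (n + 2) (Fin.castSucc i) := by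
        apply Fin.ext; simp
      rw [hidx]; exact hnull (Fin.castSucc i)) (by
      have hfam : (fun i : Fin ((n + 2) + r) => setInd (U (univ.erase (e (Fin.castSucc i))))) = Fin.init f := by
        funext i; rw [Fin.init, hf]
      rw [hfam]; exact hinit)
    have hidx : ∀ i : Fin (n + 2), (Fin.castSucc (Fin.castAdd r i) : Fin ((n + 2) + (r + 1))) = Fin.castAdd (r + 1) i :=
      fun i => Fin.ext (by simp)
    simp only [hidx] at key
    exact key

/-- **BASE CASE of the transfer induction.**  For a probability weight on `Sun m` with `E_m(row) ≥ 0` and an injective `x : Fin (n+2) → Fin m`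
such that every petal outside the range of `x` is null, the sub-row `E_{n+2}(χ_{U([m] ∖ x i)} : i)` is `≥ 0`. [this work] -/
theorem sahiE_subrow_nonneg_of_null {ν : Sun m → ℝ} (hν0 : ∀ y, 0 ≤ ν y) (hν1 : ∑ y, ν y = 1)
    (hrow : 0 ≤ sahiE ν m (fun i => setInd (U (univ.erase i)))) {n : ℕ} (x : Fin (n + 2) → Fin m) (hx : Function.Injective x)
    (hnull : ∀ j, (∀ i, x i ≠ j) → ν (pet j) = 0) :
    0 ≤ sahiE ν (n + 2) (fun i => setInd (U (univ.erase (x i)))) := by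
  have hnm : n + 2 ≤ m := by simpa using Fintype.card_le_of_injective x hx
  obtain ⟨r, rfl⟩ := Nat.exists_eq_add_of_le hnm
  obtain ⟨σ, hσ⟩ := exists_perm_normalising x hx hnm
  -- the row, re-indexed by `σ⁻¹`
  set e : Fin ((n + 2) + r) → Fin ((n + 2) + r) := fun i => σ.symm i with he
  have hrow' : 0 ≤ sahiE ν ((n + 2) + r) (fun i => setInd (U (univ.erase (e i)))) := by
    have hperm := sahiE_comp_perm ν ((n + 2) + r) σ (fun i => setInd (U (univ.erase (e i))))
    have hfam : (fun i => (fun i => setInd (U (univ.erase (e i)))) (σ i)) = fun i => setInd (U (univ.erase i)) := by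
      funext i; simp [he]
    rw [hfam] at hperm
    rw [← hperm]; exact hrow
  have hnull' : ∀ i : Fin r, ν (pet (e (Fin.natAdd (n + 2) i))) = 0 := by
    intro i
    apply hnull
    intro l hl
    have h1 : σ (x l) = Fin.natAdd (n + 2) i := by rw [hl, he]; simp
    rw [hσ l] at h1
    have h2 := congrArg Fin.val h1
    simp at h2
    omega
  have key := sahiE_subrow_nonneg_peel hν0 hν1 r e hnull' hrow'
  have hxe : ∀ i : Fin (n + 2), e (Fin.castAdd r i) = x i := by
    intro i
    rw [he]; dsimp only
    rw [Equiv.symm_apply_eq, hσ i]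
    exact Fin.ext (by simp)
  simp only [hxe] at key
  exact key

end Sun
end Summit.CriticalPhenomena.PercolationContinuityZ3.Theorems.SahiDeltaSystem
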